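import Summits.CriticalPhenomena.SAWScalingLimit.Theorems.SAWDefectDecoherenceBoundaryClosureRHexagonOscillation
import Summits.CriticalPhenomena.SAWScalingLimit.Theorems.SAWDefectDecoherenceBoundaryClosureRStarDefect
import Summits.CriticalPhenomena.SAWScalingLimit.Theorems.SAWDefectDecoherenceDecoherenceSynthesis
import HarnessLib

/-!
# Crux `BoundaryClosureR` (stmt-CriticalPhenomena-14004), line `pick-half-plane`:
the interior half of Claim D holds in the bulk under `DefectDecoherence`

Lead helper file (serves `stub_halfPlaneInputs`, interior half `HexNoInteriorMax`).  Composition of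
the two landed lattice facts — central symmetry of the hexagon (`noInteriorMax_of_oscillation`,
`…HexagonOscillation`) and the star identity (`norm_edge_sub_edge_zero_le`, `…StarDefect`):

* `noInteriorMax_of_small_star_defects` — if the six conjugated star defects at the corners of an
  interior hexagon are `≤ d` with `648·d² < ‖F(edge₀)‖²` (`d < ‖F(edge₀)‖/(18√2)`), some neighbour
  of the site has strictly larger `Re H`, for every potential `H` of `F dz`;
* `noInteriorMax_of_defectDecoherence` — hence the route's crux `DefectDecoherence` (conjugated
  star sums at `R`-deep vertices are `≤ C·R^{−θ}·(local arrival mass)`, `θ > 3/4`) yields the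
  interior half of Claim D at every hexagon of depth `R` whose observable dominates its corner
  masses at that rate: `648·(C R^{−θ} M)² < ‖F(edge₀)‖²`.  At macroscopic depth `R = dist/δ` and
  away from the zeros of the limit this holds eventually (`|F|/Z ≍ δ^{25/48} ≫ δ^θ`, the exponent
  cut of the route), so the OPEN content of `HexNoInteriorMax` sits in the boundary layer and
  near zeros of the limit.
-/

noncomputable section

open scoped BigOperators ComplexConjugate
open Literature.Probability.LatticeModels Literature.Probability.RandomPlanarGeometry
open Literature.Probability.RandomPlanarGeometry.SAW
open Literature.Barriers.CriticalPhenomena Literature.Barriers.CriticalPhenomena.HexKernel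
open Summit.CriticalPhenomena.SAWScalingLimit.Theorems.PickHalfPlane
open Summit.CriticalPhenomena.SAWScalingLimit.Theorems.PickHalfPlane.Hexagon
open Summit.CriticalPhenomena.SAWScalingLimit.Theorems.PickHalfPlane.StarDefect
open Summit.CriticalPhenomena.SAWScalingLimit.Theses.SAWDefectDecoherence
open Summit.CriticalPhenomena.SAWScalingLimit.Cruxes.DefectDecoherence.TipMartingaleDepthInduction.WallExitTwoPoint
  (dist_hexCenter_le_one_of_adj)

namespace Summit.CriticalPhenomena.SAWScalingLimit.Theorems.PickHalfPlane.Bulk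

/-- **No interior maximum where the corner defects are small against the observable.**
[cite: DuminilCopinSmirnov2012, Lemma 1] -/
theorem noInteriorMax_of_small_star_defects {Λ : Finset HexVertex} (hΛ : hexDomainSimplyConnected Λ)
    {a : Sym2 HexVertex} (ha : a ∈ hexDomainBoundary Λ) {H : Site 2 → ℂ} (hH : IsPotential Λ a H)
    {s : Site 2} (hs : IsInteriorSite Λ s) {d : ℝ}
    (hd : ∀ j : Fin 6,
      ‖conjStarSum (hexParafermionicObservable Λ a hexCriticalFugacity (5 / 8)) s j‖ ≤ d)
    (hdom : 648 * d ^ 2 <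
      ‖hexParafermionicObservable Λ a hexCriticalFugacity (5 / 8) (edge s 0)‖ ^ 2) :
    ∃ t ∈ siteNbrs s, (H s).re < (H t).re := by
  set F : Sym2 HexVertex → ℂ := hexParafermionicObservable Λ a hexCriticalFugacity (5 / 8) with hF
  have hrel : SatisfiesVertexRelations Λ F :=
    (lemma1_iff.1 DuminilCopinSmirnov2012_lemma1_holds) Λ hΛ a ha
  have hv : ∀ j : Fin 6, face s j ∈ Λ := fun j => hs _ (mem_hexFaceVertices_face s j)
  have hosc := norm_edge_sub_edge_zero_le hrel s hv hd
  set P : ℂ := F (edge s 0) with hP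
  have d0 : 0 ≤ d := le_trans (norm_nonneg _) (hd 0)
  have hP0 : P ≠ 0 := by
    intro h0
    rw [h0, norm_zero] at hdom
    nlinarith [sq_nonneg d]
  have hPpos : 0 < ‖P‖ := norm_pos_iff.2 hP0
  -- oscillation `≤ 6d = η‖P‖` with `η = 6d/‖P‖`, `18η² < 1 ⟺ 648 d² < ‖P‖²`
  refine noInteriorMax_of_oscillation hH hs hP0 (η := 6 * d / ‖P‖) (by positivity) ?_ ?_
  · have h1 : (6 * d / ‖P‖) ^ 2 = 36 * d ^ 2 / ‖P‖ ^ 2 := by ring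
    rw [h1, ← mul_div_assoc, div_lt_one (by positivity)]
    linarith
  · intro k
    have := hosc k
    rwa [div_mul_cancel₀ _ hPpos.ne']

/-- The conjugated star sum of `DefectDecoherence` at the corner `face s (k+1)`, whose three
neighbours lie in `Λ`, IS `conjStarSum F s k`. [folklore] -/
theorem filter_sum_conj_eq_conjStarSum {Λ : Finset HexVertex} (F : Sym2 HexVertex → ℂ) (s : Site 2)
    (k : Fin 6) (h1 : face s k ∈ Λ) (h2 : face s (k + 1 + 1) ∈ Λ) (h3 : outFace s (k + 1) ∈ Λ) :
    ∑ t ∈ Λ.filter (fun t => hexGraph.Adj (face s (k + 1)) t),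
        (starRingEnd ℂ) (hexMidpoint s(face s (k + 1), t) - hexCenter (face s (k + 1))) *
          F s(face s (k + 1), t) = conjStarSum F s k := by
  classical
  have hset : Λ.filter (fun t => hexGraph.Adj (face s (k + 1)) t) =
      {face s k, face s (k + 1 + 1), outFace s (k + 1)} := by
    ext t
    rw [Finset.mem_filter, adj_face_iff HexKernel.hexGraph_adj_iff_of_snd_eq_zero_holds
      HexKernel.not_hexGraph_adj_of_snd_eq_holds]
    constructor
    · rintro ⟨-, h | h | h⟩ <;> simp [h]
    · intro ht
      simp only [Finset.mem_insert, Finset.mem_singleton] at ht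
      rcases ht with rfl | rfl | rfl
      · exact ⟨h1, Or.inl rfl⟩
      · exact ⟨h2, Or.inr (Or.inl rfl)⟩
      · exact ⟨h3, Or.inr (Or.inr rfl)⟩
  have hne12 : face s k ≠ face s (k + 1 + 1) := by
    rw [Ne, face_inj]; intro h; have := congrArg Fin.val h; simp [Fin.val_add] at this; omega
  have hne13 : face s k ≠ outFace s (k + 1) := fun h => outFace_ne_face s (k + 1) k h.symm
  have hne23 : face s (k + 1 + 1) ≠ outFace s (k + 1) := fun h =>
    outFace_ne_face s (k + 1) (k + 1 + 1) h.symm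
  rw [hset, Finset.sum_insert (by simp [hne12, hne13]), Finset.sum_insert (by simp [hne23]),
    Finset.sum_singleton]
  unfold conjStarSum HexKernel.edge
  rw [Sym2.eq_swap (a := face s k)]
  ring

/-- The same bookkeeping for the local arrival mass. [folklore] -/
theorem filter_sum_norm_eq {Λ : Finset HexVertex} (G : Sym2 HexVertex → ℂ) (s : Site 2)
    (k : Fin 6) (h1 : face s k ∈ Λ) (h2 : face s (k + 1 + 1) ∈ Λ) (h3 : outFace s (k + 1) ∈ Λ) :
    ∑ t ∈ Λ.filter (fun t => hexGraph.Adj (face s (k + 1)) t), ‖G s(face s (k + 1), t)‖ =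
      ‖G (edge s k)‖ + ‖G (edge s (k + 1))‖ + ‖G s(face s (k + 1), outFace s (k + 1))‖ := by
  classical
  have hset : Λ.filter (fun t => hexGraph.Adj (face s (k + 1)) t) =
      {face s k, face s (k + 1 + 1), outFace s (k + 1)} := by
    ext t
    rw [Finset.mem_filter, adj_face_iff HexKernel.hexGraph_adj_iff_of_snd_eq_zero_holds
      HexKernel.not_hexGraph_adj_of_snd_eq_holds]
    constructor
    · rintro ⟨-, h | h | h⟩ <;> simp [h]
    · intro ht
      simp only [Finset.mem_insert, Finset.mem_singleton] at ht
      rcases ht with rfl | rfl | rfl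
      · exact ⟨h1, Or.inl rfl⟩
      · exact ⟨h2, Or.inr (Or.inl rfl)⟩
      · exact ⟨h3, Or.inr (Or.inr rfl)⟩
  have hne12 : face s k ≠ face s (k + 1 + 1) := by
    rw [Ne, face_inj]; intro h; have := congrArg Fin.val h; simp [Fin.val_add] at this; omega
  have hne13 : face s k ≠ outFace s (k + 1) := fun h => outFace_ne_face s (k + 1) k h.symm
  have hne23 : face s (k + 1 + 1) ≠ outFace s (k + 1) := fun h =>
    outFace_ne_face s (k + 1) (k + 1 + 1) h.symm
  rw [hset, Finset.sum_insert (by simp [hne12, hne13]), Finset.sum_insert (by simp [hne23]),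
    Finset.sum_singleton]
  unfold HexKernel.edge
  rw [Sym2.eq_swap (a := face s k)]
  ring

/-- **The interior half of Claim D in the bulk, from the route's crux `DefectDecoherence`.**
`DefectDecoherence` provides `C` and `θ > 3/4`; then for every simply connected `Λ`, boundary root
`{u ∉ Λ, w ∈ Λ}`, potential `H` of the observable, and interior site `s` whose six hexagon corners
are `R`-deep (`R ≥ 1`) with corner arrival masses `≤ M`, the dominance
`648·(C·R^{−θ}·M)² < ‖F(edge₀)‖²` forces a neighbour with strictly larger `Re H`.
[cite: DuminilCopinSmirnov2012, §4] -/
theorem noInteriorMax_of_defectDecoherence (hDD : DefectDecoherence) :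
    ∃ C θ : ℝ, 3 / 4 < θ ∧ ∀ (Λ : Finset HexVertex), hexDomainSimplyConnected Λ →
      ∀ (u w : HexVertex), hexGraph.Adj u w → u ∉ Λ → w ∈ Λ →
      ∀ (H : Site 2 → ℂ), IsPotential Λ s(u, w) H →
      ∀ (s : Site 2), IsInteriorSite Λ s →
      ∀ (R M : ℝ), 1 ≤ R →
        (∀ (j : Fin 6) (y : HexVertex), dist (hexCenter y) (hexCenter (face s j)) ≤ R → y ∈ Λ) →
        (∀ j : Fin 6, ∑ t ∈ Λ.filter (fun t => hexGraph.Adj (face s j) t),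
            ‖hexParafermionicObservable Λ s(u, w) hexCriticalFugacity 0 s(face s j, t)‖ ≤ M) →
        648 * (C * R ^ (-θ) * M) ^ 2 <
            ‖hexParafermionicObservable Λ s(u, w) hexCriticalFugacity (5 / 8) (edge s 0)‖ ^ 2 →
        ∃ t ∈ siteNbrs s, (H s).re < (H t).re := by
  obtain ⟨C, θ, hθ, hDD⟩ := hDD
  refine ⟨C, θ, hθ, fun Λ hΛ u w huw hu hw H hH s hs R M hR hdeep hM hdom => ?_⟩
  have ha : s(u, w) ∈ hexDomainBoundary Λ :=
    ⟨(SimpleGraph.mem_edgeSet hexGraph).2 huw, u, w, rfl, hw, hu⟩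
  have hv : ∀ j : Fin 6, face s j ∈ Λ := fun j => hs _ (mem_hexFaceVertices_face s j)
  have hout : ∀ j : Fin 6, outFace s j ∈ Λ := fun j => by
    refine hdeep j _ (le_trans ?_ hR)
    -- adjacent faces are at distance `1/√3 ≤ 1`
    have hadj : hexGraph.Adj (face s j) (outFace s j) := by
      obtain ⟨i, rfl⟩ : ∃ i, j = i + 1 := ⟨j - 1, (sub_add_cancel j 1).symm⟩
      exact (adj_face_iff HexKernel.hexGraph_adj_iff_of_snd_eq_zero_holds
        HexKernel.not_hexGraph_adj_of_snd_eq_holds s i _).2 (Or.inr (Or.inr rfl))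
    exact dist_hexCenter_le_one_of_adj hadj
  -- the defect bound at each corner, rewritten as `‖conjStarSum‖ ≤ |C| R^{-θ} M`
  have hRθ : 0 ≤ R ^ (-θ) := Real.rpow_nonneg (by linarith) _
  have hd : ∀ j : Fin 6,
      ‖conjStarSum (hexParafermionicObservable Λ s(u, w) hexCriticalFugacity (5 / 8)) s j‖ ≤
        |C| * R ^ (-θ) * M := by
    intro j
    have key := hDD Λ hΛ u w huw hu hw (face s (j + 1)) R hR (hdeep (j + 1))
    rw [filter_sum_conj_eq_conjStarSum _ s j (hv j) (hv _) (hout _)] at key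
    set S : ℝ := ∑ t ∈ Λ.filter (fun t => hexGraph.Adj (face s (j + 1)) t),
      ‖hexParafermionicObservable Λ s(u, w) hexCriticalFugacity 0 s(face s (j + 1), t)‖ with hS
    have hS0 : 0 ≤ S := Finset.sum_nonneg fun _ _ => norm_nonneg _
    calc _ ≤ C * R ^ (-θ) * S := key
      _ ≤ |C| * R ^ (-θ) * S := by
          have := le_abs_self C
          have h2 : 0 ≤ R ^ (-θ) * S := mul_nonneg hRθ hS0
          nlinarith
      _ ≤ |C| * R ^ (-θ) * M := mul_le_mul_of_nonneg_left (hM (j + 1)) (by positivity)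
  have hdom' : 648 * (|C| * R ^ (-θ) * M) ^ 2 <
      ‖hexParafermionicObservable Λ s(u, w) hexCriticalFugacity (5 / 8) (edge s 0)‖ ^ 2 := by
    have : (|C| * R ^ (-θ) * M) ^ 2 = (C * R ^ (-θ) * M) ^ 2 := by
      rw [mul_assoc, mul_assoc, mul_pow |C|, mul_pow C, sq_abs]
    rw [this]; exact hdom
  exact noInteriorMax_of_small_star_defects hΛ ha hH hs hd hdom'

/-- Registered sub-goal `stub_halfPlaneInputs_bulk` of crux stmt-CriticalPhenomena-14004 (line
`pick-half-plane`, interior half of `stub_halfPlaneInputs`): the closed form of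
`noInteriorMax_of_defectDecoherence` — the route's crux `DefectDecoherence` gives the interior half of
Claim D at every deep hexagon where the observable dominates its corner masses at rate `R^{−θ}`.
[cite: DuminilCopinSmirnov2012, §4] -/
theorem stub_halfPlaneInputs_bulk : DefectDecoherence → ∃ C θ : ℝ, 3 / 4 < θ ∧ ∀ (Λ : Finset HexVertex), hexDomainSimplyConnected Λ → ∀ (u w : HexVertex), hexGraph.Adj u w → u ∉ Λ → w ∈ Λ → ∀ (H : Site 2 → ℂ), IsPotential Λ s(u, w) H → ∀ (s : Site 2), IsInteriorSite Λ s → ∀ (R M : ℝ), 1 ≤ R → (∀ (j : Fin 6) (y : HexVertex), dist (hexCenter y) (hexCenter (HexKernel.face s j)) ≤ R → y ∈ Λ) → (∀ j : Fin 6, ∑ t ∈ Λ.filter (fun t => hexGraph.Adj (HexKernel.face s j) t), ‖hexParafermionicObservable Λ s(u, w) hexCriticalFugacity 0 s(HexKernel.face s j, t)‖ ≤ M) → 648 * (C * R ^ (-θ) * M) ^ 2 < ‖hexParafermionicObservable Λ s(u, w) hexCriticalFugacity (5 / 8) (HexKernel.edge s 0)‖ ^ 2 → ∃ t ∈ siteNbrs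 s, (H s).re < (H t).re :=
  noInteriorMax_of_defectDecoherence

end Summit.CriticalPhenomena.SAWScalingLimit.Theorems.PickHalfPlane.Bulk
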